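import Mathlib
import HarnessLib
import Summits.HubbardSuperconductivity.HubbardSuperconductivity.Theorems.KLProgrammeKLRegimeTwoVolumeSourceSmoothDefs

/-!
# Route `KLProgramme` — crux K3, VL child `KLRegimeVolumeLimitV17F3` (stmt-HubbardSuperconductivity-23356), located point LR13′
# «(VL)-HUV-CURRENCY-PROPAGATION» (pen (R303); answered YES by the VL lead k3c4-p1 g20, memo `LR13PRIME-g20.md`):
# TOKEN #24's CARRIERS WITH A GENERIC SOURCE FAMILY `F` (definitions; seat hubbard-kl-k3c4-p1 g20; definition lane)

`…TwoVolumeSourceProfileDefs` (§ family-decoupled carriers) analyses the SOURCE copy (copy `1`, sector slot `0`) of the doubled labels by the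
PLAIN field `sectorAnalysisMatrix … (trivialMultiplier L M)`; `…TwoVolumeSourceSmoothDefs.klSrcAnalysisAtW` analyses it by the time-WINDOWED field
`sectorAnalysisMatrix … (srcWindowFamily L M)` (pen (R235) «KEY = WINDOW»).  The blocked source tower of the producer route «(VL)-SRC-SOFT»
(`…TwoVolumeSrcBlockIdentity` … `…TwoVolumeSrcTowerProducer`) never integrates, transforms or weighs the source copy (block covariance `C⁺` zero on
copy `1`, transfer `T⁺ = (ε•E(F_{J′})S(F̃)) ⊕ J` with `J` the slot identity), so it is blind to the source family; the UV lane «(VL)-SRC-UV» can supply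
`M`-uniform profiles only in the windowed currency (the plain block `E_plain·S_{4M}` has Dirichlet rows `≍ ln M`, k3c2-p3 «BLOCK0-LOGM»).  This file
therefore restates the four carriers and the doubled read-out with the source copy analysed by an ARBITRARY one-sector family
`F : Fin 1 → FreqMomentum L M → ℂ`:
* `klSrcAnalysisAtF … F J`, `klSrcActionAtF … F J n`, `klSrcPinnedSumAtF … F J r n s m q w`, **`SourceProfilesAtLevF S … F J r n`** (token #24-F),
  `klTowerDF … F k := map (toLin' (ε • klSrcAnalysisAtF … F k)) 𝒱_{k+1}` (the doubled read-out, `…TwoVolumeTowerDefs.klTowerD` at a generic family);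
* `rfl` rows: at `F = trivialMultiplier L M` they ARE the plain carriers (`…_trivial`), at `F = srcWindowFamily L M` the analysis IS `klSrcAnalysisAtW`
  (`klSrcAnalysisAtF_srcWindowFamily`);
* bookkeeping: `klSrcAnalysisAtF_smul_apply/_apply_alive/_apply_src/_apply_dead`, `klSrcPinnedSumAtF_def/_nonneg`, `sourceProfilesAtLevF_of_forall`,
  `SourceProfilesAtLevF.mono/.one/.two`.
Definitions + `rfl`/elementary unfoldings only; nothing about the model's sizes is asserted.  [cite: BenfattoGiulianiMastropietro2006, §2.7 (2.70)-(2.71), §2.9 (4.3)-(4.8)]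
-/

noncomputable section

namespace Summit.HubbardSuperconductivity.HubbardSuperconductivity.Theorems.TwoVolumeSource

set_option linter.dupNamespace false -- summit = problem name (single-conjunct summit), D-0017

open Real Finset Literature.MathematicalPhysics.QuantumLattice Literature.Probability.LatticeModels GrassmannAlgebra
open Summit.HubbardSuperconductivity.HubbardSuperconductivity.Theorems.KLProgrammeLegKernels
open Summit.HubbardSuperconductivity.HubbardSuperconductivity.Theorems.KLRegimeSplit
open Summit.HubbardSuperconductivity.HubbardSuperconductivity.Theorems.EngineV8

variable (L M : ℕ) [NeZero L]

/-- **The doubled analysis matrix with the alive family `F_J` and the SOURCE family `F`**: copy `0` ↦ `E(F_J)`, copy `1`, sector slot `0` ↦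
`sectorAnalysisMatrix … F` (the source field analysed by the one-sector family `F`), other slots ↦ `0`.
[cite: BenfattoGiulianiMastropietro2006, §2.7 (2.70), §2.9 (4.6)] -/
def klSrcAnalysisAtF (β μ : ℝ) (K : TrigPolyC4v) (F : Fin 1 → FreqMomentum L M → ℂ) (J : ℕ) : Matrix (SrcLabel L M J) (HubbardFieldIdx L M) ℂ :=
  Matrix.of fun Y X => if Y.2 = 0 then sectorAnalysisMatrix L M β (klAnisoFamily L M β μ K klE0 J) Y.1 X
    else if (Y.1.2.1.1 : ℕ) = 0 then sectorAnalysisMatrix L M β F (Y.1.1, (((0 : Fin 1), Y.1.2.1.2), Y.1.2.2)) X else 0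

/-- **The doubled-analysed scale-`n` action with the alive family `F_J` and the source family `F`**: `map (toLin' (klSrcAnalysisAtF … F J)) 𝒱⁽ⁿ⁾`.
[cite: BenfattoGiulianiMastropietro2006, §2.7 (2.70)-(2.71)] -/
def klSrcActionAtF (β U μ : ℝ) (K : TrigPolyC4v) (F : Fin 1 → FreqMomentum L M → ℂ) (J n : ℕ) : GrassmannAlgebra ℂ (SrcLabel L M J) :=
  ExteriorAlgebra.map (Matrix.toLin' (klSrcAnalysisAtF L M β μ K F J)) (klEffectiveAction L M β U μ K klE0 n)

/-- **The source-graded weighted pinned sum with the source family `F`**: degree `m`, exactly `s` source legs, leg `q` pinned at `w`, tree weight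
`klScaleWt … r` of the position image (the format of `klSrcPinnedSumAt`). [cite: BenfattoGiulianiMastropietro2006, §2.7 (2.71)] -/
def klSrcPinnedSumAtF (β U μ : ℝ) (K : TrigPolyC4v) (F : Fin 1 → FreqMomentum L M → ℂ) (J r n s m : ℕ) (q : Fin m) (w : SrcLabel L M J) : ℝ :=
  imagTimeWeight β M ^ (m - 1) *
    ∑ X ∈ univ.filter (fun X : Fin m → SrcLabel L M J => X q = w ∧ srcCount (fun Y : SrcLabel L M J => Y.2 = 1) X = s),
      klScaleWt L M β r ((univ.image X).image (srcLegPos L M (2 * (2 * M)))) * ‖kernel ℂ (klSrcActionAtF L M β U μ K F J n) m X‖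

/-- **`SourceProfilesAtLevF S … F J r n` — TOKEN #24 with the source family `F`**: the source-sector profiles (one and two source legs) of `𝒱⁽ⁿ⁾`
analysed at the alive family `F_J` and the source family `F`, weighed at rate `r`, within the graded budget `S s m`.
[cite: BenfattoGiulianiMastropietro2006, §2.9 (4.3)-(4.8)] -/
def SourceProfilesAtLevF (S : ℕ → ℕ → ℝ) (β U μ : ℝ) (K : TrigPolyC4v) (F : Fin 1 → FreqMomentum L M → ℂ) (J r n : ℕ) : Prop :=
  ∀ (s : ℕ), 1 ≤ s → s ≤ 2 → ∀ (m : ℕ) (q : Fin m) (w : SrcLabel L M J), klSrcPinnedSumAtF L M β U μ K F J r n s m q w ≤ S s m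

/-- **The doubled read-out of step `k + 1` with the source family `F`**: `map (toLin' (ε • klSrcAnalysisAtF … F k)) 𝒱_{k+1}`
(`…TwoVolumeTowerDefs.klTowerD` at a generic source family). [cite: BenfattoGiulianiMastropietro2006, §2.7 (2.70)-(2.71)] -/
def klTowerDF (β U μ : ℝ) (K : TrigPolyC4v) (F : Fin 1 → FreqMomentum L M → ℂ) (k : ℕ) : GrassmannAlgebra ℂ (SrcLabel L M k) :=
  ExteriorAlgebra.map (Matrix.toLin' ((((imagTimeWeight β M : ℝ) : ℂ)) • klSrcAnalysisAtF L M β μ K F k)) (klEffectiveAction L M β U μ K klE0 (k + 1))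

variable {L M}

/-! ### The `rfl` rows: plain family, windowed family -/

omit [NeZero L] in
/-- At `F = trivialMultiplier` the analysis IS `klSrcAnalysisAt` (`rfl`). -/
theorem klSrcAnalysisAtF_trivial (β μ : ℝ) (K : TrigPolyC4v) (J : ℕ) :
    klSrcAnalysisAtF L M β μ K (trivialMultiplier L M) J = klSrcAnalysisAt L M β μ K J := rfl

/-- At `F = trivialMultiplier` the action IS `klSrcActionAt` (`rfl`). -/
theorem klSrcActionAtF_trivial (β U μ : ℝ) (K : TrigPolyC4v) (J n : ℕ) :
    klSrcActionAtF L M β U μ K (trivialMultiplier L M) J n = klSrcActionAt L M β U μ K J n := rfl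

/-- At `F = trivialMultiplier` the pinned sum IS `klSrcPinnedSumAt` (`rfl`). -/
theorem klSrcPinnedSumAtF_trivial (β U μ : ℝ) (K : TrigPolyC4v) (J r n s m : ℕ) (q : Fin m) (w : SrcLabel L M J) :
    klSrcPinnedSumAtF L M β U μ K (trivialMultiplier L M) J r n s m q w = klSrcPinnedSumAt L M β U μ K J r n s m q w := rfl

/-- At `F = trivialMultiplier` the token IS `SourceProfilesAtLev` (`Iff.rfl`). -/
theorem sourceProfilesAtLevF_trivial_iff (S : ℕ → ℕ → ℝ) (β U μ : ℝ) (K : TrigPolyC4v) (J r n : ℕ) :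
    SourceProfilesAtLevF L M S β U μ K (trivialMultiplier L M) J r n ↔ SourceProfilesAtLev L M S β U μ K J r n := Iff.rfl

/-- At `F = trivialMultiplier` the read-out IS `klTowerD` (`rfl`). -/
theorem klTowerDF_trivial [NeZero M] (β U μ : ℝ) (K : TrigPolyC4v) (k : ℕ) :
    klTowerDF L M β U μ K (trivialMultiplier L M) k = klTowerD L M β U μ K k := rfl

omit [NeZero L] in
/-- At `F = srcWindowFamily` the analysis IS the windowed analysis `klSrcAnalysisAtW` (`rfl`). -/
theorem klSrcAnalysisAtF_srcWindowFamily (β μ : ℝ) (K : TrigPolyC4v) (J : ℕ) :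
    klSrcAnalysisAtF L M β μ K (srcWindowFamily L M) J = klSrcAnalysisAtW L M β μ K J := rfl

/-! ### Entries of the analysis -/

omit [NeZero L] in
/-- Entries of `klSrcAnalysisAtF`. -/
theorem klSrcAnalysisAtF_apply (β μ : ℝ) (K : TrigPolyC4v) (F : Fin 1 → FreqMomentum L M → ℂ) (J : ℕ) (Y : SrcLabel L M J) (X : HubbardFieldIdx L M) :
    klSrcAnalysisAtF L M β μ K F J Y X = if Y.2 = 0 then sectorAnalysisMatrix L M β (klAnisoFamily L M β μ K klE0 J) Y.1 X
      else if (Y.1.2.1.1 : ℕ) = 0 then sectorAnalysisMatrix L M β F (Y.1.1, (((0 : Fin 1), Y.1.2.1.2), Y.1.2.2)) X else 0 := rfl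

omit [NeZero L] in
/-- Alive rows of `klSrcAnalysisAtF` are the rows of `E(F_J)`. -/
theorem klSrcAnalysisAtF_apply_alive (β μ : ℝ) (K : TrigPolyC4v) (F : Fin 1 → FreqMomentum L M → ℂ) (J : ℕ) (Y : SrcLabel L M J) (hY : Y.2 = 0)
    (X : HubbardFieldIdx L M) : klSrcAnalysisAtF L M β μ K F J Y X = sectorAnalysisMatrix L M β (klAnisoFamily L M β μ K klE0 J) Y.1 X := by
  rw [klSrcAnalysisAtF_apply, if_pos hY]

omit [NeZero L] in
/-- Slot-`0` source rows of `klSrcAnalysisAtF` are the rows of `E(F)`. -/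
theorem klSrcAnalysisAtF_apply_src (β μ : ℝ) (K : TrigPolyC4v) (F : Fin 1 → FreqMomentum L M → ℂ) (J : ℕ) (Y : SrcLabel L M J) (hY : Y.2 = 1)
    (h0 : (Y.1.2.1.1 : ℕ) = 0) (X : HubbardFieldIdx L M) :
    klSrcAnalysisAtF L M β μ K F J Y X = sectorAnalysisMatrix L M β F (Y.1.1, (((0 : Fin 1), Y.1.2.1.2), Y.1.2.2)) X := by
  rw [klSrcAnalysisAtF_apply, if_neg (by rw [hY]; decide), if_pos h0]

omit [NeZero L] in
/-- The other source rows of `klSrcAnalysisAtF` vanish. -/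
theorem klSrcAnalysisAtF_apply_dead (β μ : ℝ) (K : TrigPolyC4v) (F : Fin 1 → FreqMomentum L M → ℂ) (J : ℕ) (Y : SrcLabel L M J) (hY : Y.2 = 1)
    (h0 : (Y.1.2.1.1 : ℕ) ≠ 0) (X : HubbardFieldIdx L M) : klSrcAnalysisAtF L M β μ K F J Y X = 0 := by
  rw [klSrcAnalysisAtF_apply, if_neg (by rw [hY]; decide), if_neg h0]

omit [NeZero L] in
/-- **The rows of `ε • klSrcAnalysisAtF … F J` in doubled-rows form**: copy `0` ↦ `(ε • E(F_J))`, copy `1` ↦ the ε-scaled source block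
`B Y X = if slot(Y) = 0 then ε·E(F)((x_Y, ((0, σ_Y), c_Y)), X) else 0` (the shape `…SrcTowerIdentity.srcSlotShift_mul_srcPlain` consumes). -/
theorem klSrcAnalysisAtF_smul_apply (β μ : ℝ) (K : TrigPolyC4v) (F : Fin 1 → FreqMomentum L M → ℂ) (J : ℕ) (p : SrcLabel L M J) (X : HubbardFieldIdx L M) :
    ((((imagTimeWeight β M : ℝ) : ℂ)) • klSrcAnalysisAtF L M β μ K F J) p X =
      if p.2 = 0 then ((((imagTimeWeight β M : ℝ) : ℂ)) • sectorAnalysisMatrix L M β (klAnisoFamily L M β μ K klE0 J)) p.1 X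
      else (if (p.1.2.1.1 : ℕ) = 0 then (((imagTimeWeight β M : ℝ) : ℂ)) *
        sectorAnalysisMatrix L M β F (p.1.1, (((0 : Fin 1), p.1.2.1.2), p.1.2.2)) X else 0) := by
  rw [Matrix.smul_apply, klSrcAnalysisAtF, Matrix.of_apply]
  by_cases h0 : p.2 = 0
  · simp only [h0, if_true, Matrix.smul_apply, smul_eq_mul]
  · simp only [h0, if_false, smul_eq_mul]
    split_ifs <;> simp

/-! ### Bookkeeping of the pinned sum and the token -/

/-- Unfolding `klSrcPinnedSumAtF`. -/
theorem klSrcPinnedSumAtF_def (β U μ : ℝ) (K : TrigPolyC4v) (F : Fin 1 → FreqMomentum L M → ℂ) (J r n s m : ℕ) (q : Fin m) (w : SrcLabel L M J) :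
    klSrcPinnedSumAtF L M β U μ K F J r n s m q w = imagTimeWeight β M ^ (m - 1) *
      ∑ X ∈ univ.filter (fun X : Fin m → SrcLabel L M J => X q = w ∧ srcCount (fun Y : SrcLabel L M J => Y.2 = 1) X = s),
        klScaleWt L M β r ((univ.image X).image (srcLegPos L M (2 * (2 * M)))) * ‖kernel ℂ (klSrcActionAtF L M β U μ K F J n) m X‖ := rfl

/-- `0 ≤ klSrcPinnedSumAtF` (`β ≥ 0`). -/
theorem klSrcPinnedSumAtF_nonneg {β : ℝ} (hβ : 0 ≤ β) (U μ : ℝ) (K : TrigPolyC4v) (F : Fin 1 → FreqMomentum L M → ℂ) (J r n s m : ℕ) (q : Fin m)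
    (w : SrcLabel L M J) : 0 ≤ klSrcPinnedSumAtF L M β U μ K F J r n s m q w :=
  mul_nonneg (pow_nonneg (imagTimeWeight_nonneg hβ M) _)
    (sum_nonneg fun _ _ => mul_nonneg (zero_le_one.trans (one_le_klScaleWt L M β r _)) (norm_nonneg _))

/-- Intro form. -/
theorem sourceProfilesAtLevF_of_forall {S : ℕ → ℕ → ℝ} {β U μ : ℝ} {K : TrigPolyC4v} {F : Fin 1 → FreqMomentum L M → ℂ} {J r n : ℕ}
    (h : ∀ (s : ℕ), 1 ≤ s → s ≤ 2 → ∀ (m : ℕ) (q : Fin m) (w : SrcLabel L M J), klSrcPinnedSumAtF L M β U μ K F J r n s m q w ≤ S s m) :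
    SourceProfilesAtLevF L M S β U μ K F J r n := h

/-- A larger budget is still met. -/
theorem SourceProfilesAtLevF.mono {S S' : ℕ → ℕ → ℝ} {β U μ : ℝ} {K : TrigPolyC4v} {F : Fin 1 → FreqMomentum L M → ℂ} {J r n : ℕ}
    (h : SourceProfilesAtLevF L M S β U μ K F J r n) (hSS' : ∀ s m, S s m ≤ S' s m) : SourceProfilesAtLevF L M S' β U μ K F J r n :=
  fun s hs hs2 m q w => (h s hs hs2 m q w).trans (hSS' s m)

/-- The one-source-leg clause. -/
theorem SourceProfilesAtLevF.one {S : ℕ → ℕ → ℝ} {β U μ : ℝ} {K : TrigPolyC4v} {F : Fin 1 → FreqMomentum L M → ℂ} {J r n : ℕ}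
    (h : SourceProfilesAtLevF L M S β U μ K F J r n) (m : ℕ) (q : Fin m) (w : SrcLabel L M J) :
    klSrcPinnedSumAtF L M β U μ K F J r n 1 m q w ≤ S 1 m :=
  h 1 le_rfl (by norm_num) m q w

/-- The two-source-leg clause. -/
theorem SourceProfilesAtLevF.two {S : ℕ → ℕ → ℝ} {β U μ : ℝ} {K : TrigPolyC4v} {F : Fin 1 → FreqMomentum L M → ℂ} {J r n : ℕ}
    (h : SourceProfilesAtLevF L M S β U μ K F J r n) (m : ℕ) (q : Fin m) (w : SrcLabel L M J) :
    klSrcPinnedSumAtF L M β U μ K F J r n 2 m q w ≤ S 2 m :=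
  h 2 (by norm_num) le_rfl m q w

/-- Unfolding `klTowerDF`. -/
theorem klTowerDF_def [NeZero M] (β U μ : ℝ) (K : TrigPolyC4v) (F : Fin 1 → FreqMomentum L M → ℂ) (k : ℕ) :
    klTowerDF L M β U μ K F k =
      ExteriorAlgebra.map (Matrix.toLin' ((((imagTimeWeight β M : ℝ) : ℂ)) • klSrcAnalysisAtF L M β μ K F k)) (klEffectiveAction L M β U μ K klE0 (k + 1)) := rfl

end Summit.HubbardSuperconductivity.HubbardSuperconductivity.Theorems.TwoVolumeSource

end
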